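import Mathlib

/-!
# CoshIntegral — the explicit integral of (N4.3.P2′)

Cell pub-hodge-repro2, Tier 5, sub-step N4.3 (route/T5-N4-p5.md v3, owner p5); kernel support by
seat p4.  (N4.3.P2′) computes, from Rühl's `(5-124)` and his invariant measure
`dμ = ½ sinh η dη (4π)^{-2} dψ₁ dψ₂`, the `L^p`-norms of the matrix coefficient
`c(η) = cosh(η/2)^{-2k}` of the forced vector (`k = 3/2`):

  `∫_{H¹} cosh(η/2)^{-3p} dμ = ½ ∫₀^∞ cosh(η/2)^{-3p} sinh η dη = ∫₀^∞ cosh(η/2)^{1-3p} sinh(η/2) dη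
   = 2 ∫₁^∞ x^{1-3p} dx = 2/(3p − 2)`, «`= 2` for `p = 1` and `= 1/2` for `p = 2`».

This file kernel-checks the real-variable identity behind that line (the angular factors
`(4π)^{-2} dψ₁ dψ₂` integrate to `1` and are not modelled):

* `integral_sinh_div_cosh_pow` : for `m ≥ 1`,
  `∫ η in Ioi 0, sinh (η/2) / cosh (η/2) ^ (m+1) = 2 / m`
  (antiderivative `−(2/m) cosh(η/2)^{-m}`, which tends to `0` at `+∞`; the integrand is `≥ 0`, so
  Mathlib's `integral_Ioi_of_hasDerivAt_of_nonneg` also gives integrability);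
* `integral_cosh_pow_inv_mul_sinh` : for `p ≥ 1`, the printed form
  `∫ η in Ioi 0, (cosh (η/2) ^ (3p))⁻¹ * sinh η / 2 = 2 / (3p − 2)`
  (via `sinh η = 2 sinh(η/2) cosh(η/2)`), with the two instances
  `integral_cosh_cube_inv_mul_sinh` (`p = 1`, value `2`) and
  `integral_cosh_six_inv_mul_sinh` (`p = 2`, value `1/2`), and the positivity
  `integral_cosh_pow_inv_mul_sinh_pos`.
-/

namespace Summit.Ventures.HodgeRepro2.CoshIntegral

open Real Set Filter Topology MeasureTheory

/-- The antiderivative `G_m(η) = −(2/m) · cosh(η/2)^{-m}` has derivative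
`sinh(η/2) / cosh(η/2)^(m+1)`. -/
theorem hasDerivAt_G (m : ℕ) (hm : 0 < m) (η : ℝ) :
    HasDerivAt (fun η : ℝ => -(2 / (m : ℝ)) * (Real.cosh (η / 2) ^ m)⁻¹)
      (Real.sinh (η / 2) / Real.cosh (η / 2) ^ (m + 1)) η := by
  have hc : Real.cosh (η / 2) ≠ 0 := (Real.cosh_pos _).ne'
  have h1 : HasDerivAt (fun η : ℝ => Real.cosh (η / 2)) (Real.sinh (η / 2) * (1 / 2)) η := by
    have := ((hasDerivAt_id η).div_const 2).cosh
    simpa using this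
  have h2 : HasDerivAt (fun η : ℝ => (Real.cosh (η / 2) ^ m)⁻¹)
      (-((m : ℝ) * Real.cosh (η / 2) ^ (m - 1) * (Real.sinh (η / 2) * (1 / 2))) /
        (Real.cosh (η / 2) ^ m) ^ 2) η :=
    (h1.pow m).inv (pow_ne_zero m hc)
  have h3 := h2.const_mul (-(2 / (m : ℝ)))
  refine h3.congr_deriv ?_
  have hm' : (m : ℝ) ≠ 0 := by exact_mod_cast hm.ne'
  obtain ⟨n, rfl⟩ : ∃ n, m = n + 1 := ⟨m - 1, by omega⟩
  simp only [Nat.add_sub_cancel]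
  field_simp
  ring

/-- `G_m(η) → 0` as `η → +∞` (because `cosh(η/2) ≥ η/2 → +∞`). -/
theorem tendsto_G (m : ℕ) (hm : 0 < m) :
    Tendsto (fun η : ℝ => -(2 / (m : ℝ)) * (Real.cosh (η / 2) ^ m)⁻¹) atTop (𝓝 0) := by
  have h1 : Tendsto (fun η : ℝ => η / 2) atTop atTop := tendsto_id.atTop_div_const two_pos
  have h2 : Tendsto (fun η : ℝ => Real.cosh (η / 2) ^ m) atTop atTop := by
    refine tendsto_atTop_mono (fun η => ?_) h1
    calc η / 2 ≤ Real.cosh (η / 2) := by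
          rcases le_or_gt 0 (η / 2) with h | h
          · exact (Real.self_le_sinh_iff.mpr h).trans (Real.sinh_lt_cosh _).le
          · exact h.le.trans (Real.cosh_pos _).le
      _ ≤ Real.cosh (η / 2) ^ m := le_self_pow₀ (Real.one_le_cosh _) hm.ne'
  have h3 := (h2.inv_tendsto_atTop).const_mul (-(2 / (m : ℝ)))
  simpa using h3

/-- **The explicit integral** of (N4.3.P2′): for `m ≥ 1`,
`∫₀^∞ sinh(η/2) / cosh(η/2)^(m+1) dη = 2/m`. -/
theorem integral_sinh_div_cosh_pow (m : ℕ) (hm : 0 < m) :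
    ∫ η in Ioi (0 : ℝ), Real.sinh (η / 2) / Real.cosh (η / 2) ^ (m + 1) = 2 / m := by
  have hderiv : ∀ η ∈ Ici (0 : ℝ),
      HasDerivAt (fun η : ℝ => -(2 / (m : ℝ)) * (Real.cosh (η / 2) ^ m)⁻¹)
        (Real.sinh (η / 2) / Real.cosh (η / 2) ^ (m + 1)) η :=
    fun η _ => hasDerivAt_G m hm η
  have hpos : ∀ η ∈ Ioi (0 : ℝ), 0 ≤ Real.sinh (η / 2) / Real.cosh (η / 2) ^ (m + 1) := by
    intro η hη
    exact div_nonneg (Real.sinh_nonneg_iff.mpr (div_nonneg (le_of_lt (Set.mem_Ioi.mp hη)) (by norm_num)))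
      (by positivity)
  rw [integral_Ioi_of_hasDerivAt_of_nonneg' hderiv hpos (tendsto_G m hm)]
  simp

/-- The printed form, `½ ∫₀^∞ cosh(η/2)^{-3p} sinh η dη = 2/(3p − 2)` for `p ≥ 1`
(`sinh η = 2 sinh(η/2) cosh(η/2)`). -/
theorem integral_cosh_pow_inv_mul_sinh (p : ℕ) (hp : 0 < p) :
    ∫ η in Ioi (0 : ℝ), (Real.cosh (η / 2) ^ (3 * p))⁻¹ * Real.sinh η / 2 = 2 / (3 * p - 2 : ℝ) := by
  obtain ⟨q, rfl⟩ : ∃ q, p = q + 1 := ⟨p - 1, by omega⟩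
  have hm : 0 < 3 * q + 1 := by omega
  have key := integral_sinh_div_cosh_pow (3 * q + 1) hm
  have hfun : ∀ η : ℝ, (Real.cosh (η / 2) ^ (3 * (q + 1)))⁻¹ * Real.sinh η / 2
      = Real.sinh (η / 2) / Real.cosh (η / 2) ^ (3 * q + 1 + 1) := by
    intro η
    have hc : Real.cosh (η / 2) ≠ 0 := (Real.cosh_pos _).ne'
    have hs : Real.sinh η = 2 * Real.sinh (η / 2) * Real.cosh (η / 2) := by
      rw [← Real.sinh_two_mul]; ring_nf
    rw [hs]
    field_simp
    ring
  simp_rw [hfun]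
  rw [key]
  push_cast
  ring

/-- `p = 1`: `½ ∫₀^∞ cosh(η/2)^{-3} sinh η dη = 2` (the `L¹`-norm line of P2′). -/
theorem integral_cosh_cube_inv_mul_sinh :
    ∫ η in Ioi (0 : ℝ), (Real.cosh (η / 2) ^ 3)⁻¹ * Real.sinh η / 2 = 2 := by
  have := integral_cosh_pow_inv_mul_sinh 1 one_pos
  norm_num at this
  exact this

/-- `p = 2`: `½ ∫₀^∞ cosh(η/2)^{-6} sinh η dη = 1/2` (the `L²`-norm line of P2′: the square of
the matrix coefficient `cosh(η/2)^{-3}` is integrable, with this value). -/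
theorem integral_cosh_six_inv_mul_sinh :
    ∫ η in Ioi (0 : ℝ), (Real.cosh (η / 2) ^ 6)⁻¹ * Real.sinh η / 2 = 1 / 2 := by
  have := integral_cosh_pow_inv_mul_sinh 2 two_pos
  norm_num at this
  exact this

/-- Positivity: the value `2/(3p − 2)` is `> 0` for every `p ≥ 1`. -/
theorem integral_cosh_pow_inv_mul_sinh_pos (p : ℕ) (hp : 0 < p) :
    0 < ∫ η in Ioi (0 : ℝ), (Real.cosh (η / 2) ^ (3 * p))⁻¹ * Real.sinh η / 2 := by
  rw [integral_cosh_pow_inv_mul_sinh p hp]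
  have : (1 : ℝ) ≤ p := by exact_mod_cast hp
  have : (0 : ℝ) < 3 * p - 2 := by linarith
  positivity

end Summit.Ventures.HodgeRepro2.CoshIntegral
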